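import Literature.Barriers.PneNP.LowDegreeCounterexamplesCodes
import Literature.InformationTheory.Coding.GilbertVarshamovDualBinary
import HarnessLib

/-!
# Barrier catalogue `PneNP`, Holmgren–Wein 2021 Prop. 3: the combinatorial clauses are satisfiable

Companion to `Literature/Barriers/PneNP/LowDegreeCounterexamplesCodes.lean`, whose named fact
`DecodableDualDistanceCodes` (Holmgren–Wein, *Counterexamples to the low-degree conjecture*,
ITCS 2021, Prop. 3 = LIPIcs Prop. 12, with Def. 4; after Guruswami's appendix to Shpilka 2009,
Thm. 4) asserts: there are `ζ ≥ 1/30` and binary linear codes `Cᵢ` of length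
`nᵢ = hwLength i = 42·8^{i+2}` with (a) dual distance `≥ ζnᵢ`, (b) all nonzero codeword weights
`> 2⌊ζnᵢ/2⌋`, and (c) polynomial-time bounded-distance decoding up to relative radius `ζ/2`
(`bddLanguage C θ ∈ P`).

The fact is not discharged in the tree: its explicit content is Guruswami's algebraic-geometry
codes over `𝔽₆₄` on the Garcia–Stichtenoth tower with a Welch–Berlekamp-type decoder (the
hypotheses of `Literature.Barriers.PneNP.DecodableDualDistanceCodes.of_codes64`, by which
`DecodableDualDistanceCodes` is reduced to them), i.e. function fields with Riemann–Roch and a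
machine-level running-time analysis. What this file records is that the COMBINATORIAL clauses
(a) ∧ (b) — taken alone, for the very lengths `nᵢ` and the printed constant `ζ = 1/30` — are a
theorem: `DecodableDualDistanceCodes.combinatorialClauses`, from the simultaneous
Gilbert–Varshamov argument (`Literature.InformationTheory.Coding.exists_code_weights_gt`: at every
even length `n = 2k ≥ 8` some binary linear code has all nonzero codeword weights and all nonzero
dual weights `> ⌊n/16⌋`; here `n/30 ≤ n/16 < ⌊n/16⌋ + 1` and `2⌊n/60⌋ ≤ n/30`). So the entire
remaining depth of the leaf is clause (c) for an EXPLICIT family — existence of the codes is not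
the issue, efficient unique decoding (hence explicit algebraic-geometry codes) is. This is an
existence statement about random-like codes and provides no decoder; it does not, and cannot,
replace the fact.

## References

* J. Holmgren, A. S. Wein, *Counterexamples to the low-degree conjecture*, ITCS 2021, Prop. 3 and
  Def. 3–4 (arXiv:2004.08454 p. 7; LIPIcs 185:75, Prop. 12, Defs. 8, 10, pp. 75:5–6). Held.
* A. Shpilka, *Constructions of low-degree and error-correcting ε-biased generators*, comput.
  complexity 18 (2009), Thm. 4 (p. 7) and Appendix A (V. Guruswami), pp. 23–26. Held.
* Gilbert–Varshamov: R. Lidl, G. Pilz, *Applied Abstract Algebra* (1998), Thm. 17.14 (p. 177);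
  the simultaneous (code-and-dual) random-matrix form is proved in
  `Literature/InformationTheory/Coding/GilbertVarshamovDual.lean`.
-/

namespace Literature.Barriers.PneNP

open Matrix Literature.InformationTheory.Coding

/-- The block lengths split in halves: `hwLength i = k + k` with `k = 21 · 8^{i+2}`. [folklore] -/
theorem hwLength_eq_half_add_half (i : ℕ) :
    hwLength i = 21 * 8 ^ (i + 2) + 21 * 8 ^ (i + 2) := by
  simp only [hwLength]
  ring

/-- Integer division by `16` loses less than one: `n/16 < ⌊n/16⌋ + 1` (in `ℝ`). [folklore] -/
theorem cast_div_sixteen_lt (n : ℕ) : (n : ℝ) / 16 < ((n / 16 : ℕ) : ℝ) + 1 := by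
  have h : n < n / 16 * 16 + 16 := Nat.lt_div_mul_add (by norm_num)
  have h' : (n : ℝ) < ((n / 16 : ℕ) : ℝ) * 16 + 16 := by exact_mod_cast h
  linarith

/-- **At every block length `nᵢ = 42·8^{i+2}` there is a binary linear code whose nonzero
codewords and nonzero dual words all have weight `> ⌊nᵢ/16⌋`** (the simultaneous
Gilbert–Varshamov argument, `exists_code_weights_gt`, at `k = 21·8^{i+2} ≥ 4`, `t = ⌊nᵢ/16⌋`).
[folklore] -/
theorem exists_code_weights_gt_hwLength (i : ℕ) :
    ∃ C : Submodule (ZMod 2) (Fin (hwLength i) → ZMod 2),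
      (∀ c ∈ C, c ≠ 0 → hwLength i / 16 < hammingNorm c) ∧
      (∀ y : Fin (hwLength i) → ZMod 2, (∀ c ∈ C, c ⬝ᵥ y = 0) → y ≠ 0 →
        hwLength i / 16 < hammingNorm y) :=
  exists_code_weights_gt (21 * 8 ^ (i + 2)) (hwLength i / 16)
    (le_trans (by norm_num) (Nat.le_mul_of_pos_right 21 (pow_pos (by norm_num) _)))
    (by rw [← hwLength_eq_half_add_half]; exact Nat.mul_div_le (hwLength i) 16)
    (by rw [Fintype.card_fin, hwLength_eq_half_add_half])

/-- **The combinatorial clauses (a) ∧ (b) of `DecodableDualDistanceCodes` are satisfiable, with the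
printed constant `ζ = 1/30` and at the printed lengths.** There are binary linear codes
`Cᵢ ≤ 𝔽₂^{nᵢ}`, `nᵢ = hwLength i`, such that (a) every nonzero vector orthogonal to `Cᵢ` has
Hamming weight `≥ nᵢ/30` and (b) every nonzero codeword has weight `> 2⌊nᵢ/60⌋` — literally the
first two conjuncts of `Literature.Barriers.PneNP.DecodableDualDistanceCodes` at `ζ = 1/30`. Proof:
random systematic codes (`exists_code_weights_gt_hwLength`: all these weights exceed `⌊nᵢ/16⌋`,
and `2⌊nᵢ/60⌋ ≤ nᵢ/30 ≤ nᵢ/16 < ⌊nᵢ/16⌋ + 1`). This is NOT a discharge of the fact: clause (c)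
(polynomial-time bounded-distance decoding, which forces EXPLICIT codes — Guruswami's
algebraic-geometry codes, `DecodableDualDistanceCodes.of_codes64`) is exactly what random codes do
not provide; the
theorem only certifies that (a) ∧ (b) as vendored (floors, constant, lengths) are consistent.
[folklore] -/
theorem DecodableDualDistanceCodes.combinatorialClauses :
    ∃ ζ : ℝ, 1 / 30 ≤ ζ ∧
      ∃ C : ∀ i : ℕ, Submodule (ZMod 2) (Fin (hwLength i) → ZMod 2),
        (∀ i, ∀ y : Fin (hwLength i) → ZMod 2, (∀ c ∈ C i, y ⬝ᵥ c = 0) → y ≠ 0 →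
          ζ * hwLength i ≤ hammingNorm y) ∧
        (∀ i, ∀ c ∈ C i, c ≠ 0 → 2 * ⌊ζ * hwLength i / 2⌋₊ < hammingNorm c) := by
  choose C hC₁ hC₂ using exists_code_weights_gt_hwLength
  refine ⟨1 / 30, le_rfl, C, fun i y hy hy0 => ?_, fun i c hc hc0 => ?_⟩
  · -- (a): `n/30 ≤ n/16 < ⌊n/16⌋ + 1 ≤ ‖y‖`
    have h1 : hwLength i / 16 < hammingNorm y :=
      hC₂ i y (fun c hc => by rw [dotProduct_comm]; exact hy c hc) hy0
    have h2 := cast_div_sixteen_lt (hwLength i)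
    have h3 : ((hwLength i / 16 : ℕ) : ℝ) + 1 ≤ hammingNorm y := by exact_mod_cast h1
    have h0 : (0 : ℝ) ≤ hwLength i := Nat.cast_nonneg _
    linarith
  · -- (b): `2⌊n/60⌋ ≤ n/30 ≤ n/16 < ⌊n/16⌋ + 1 ≤ ‖c‖`
    have h1 : hwLength i / 16 < hammingNorm c := hC₁ i c hc hc0
    have h2 := cast_div_sixteen_lt (hwLength i)
    have h3 : ((hwLength i / 16 : ℕ) : ℝ) + 1 ≤ hammingNorm c := by exact_mod_cast h1
    have h0 : (0 : ℝ) ≤ hwLength i := Nat.cast_nonneg _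
    have hfloor : (⌊(1 / 30 : ℝ) * hwLength i / 2⌋₊ : ℝ) ≤ 1 / 30 * hwLength i / 2 :=
      Nat.floor_le (by positivity)
    have key : ((2 * ⌊(1 / 30 : ℝ) * hwLength i / 2⌋₊ : ℕ) : ℝ) < hammingNorm c := by
      push_cast
      linarith
    exact_mod_cast key

end Literature.Barriers.PneNP
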